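import Summits.ValiantsHypothesis.ValiantsHypothesis.Theorems.KPlusLogSqLawValuativeDoorProducts

/-!
# LINE `valuative_door` (crux `WeakLifting`, stmt-ValiantsHypothesis-19561) — DOMINANT EXPONENTS OF A PRODUCT, THE COUNT:
# `#dominant (f·g) ≤ #dominant f + #dominant g − 1` (the skeleton's `npEdges v (f * g) ≤ npEdges v f + npEdges v g`), `v` non-archimedean

HONEST FRAMING.  Helper (cell `pub-symmetroid`, seat val-sym-lift-p1 g21, 2026-08-29; `--supports 19561 --as helper`), companion of
`…ValuativeDoorProducts` (which supplies `exists_dominant_pair_of_dominant_mul` and `dominantAt_mono`).  Each dominant exponent `G` of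
`f * g` splits as `a_G + b_G` with `a_G` dominant for `f` and `b_G` dominant for `g` at a common radius; as the radius grows both
coordinates move up, so the realised pairs form a CHAIN in `D(f) × D(g)` for the product order, and a chain there has at most
`#D(f) + #D(g) − 1` elements (`card_chain_le`: the rank sum is injective on a chain).  Toward the line's `ValCongruenceLemma`.  Def-free;
nothing here is a stub of the line or closes anything; no bearing on vW / vB / `ValRankOneLaw`, `TropicalB`, `MatrixDescartes` (18050) or
VP ≠ VNP.  [elementary]
-/

set_option linter.dupNamespace false
set_option autoImplicit false

namespace Summit.ValiantsHypothesis.ValiantsHypothesis.Theorems.KPlusLogSqLaw.ValDoor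

open Polynomial Finset
open scoped BigOperators Classical

variable {F : Type*} [Field F]

/-- rank of a natural number inside a finset: strictly monotone on members. [bookkeeping] -/
theorem card_filter_lt_lt {A : Finset ℕ} {x y : ℕ} (hx : x ∈ A) (hxy : x < y) :
    (A.filter fun z => z < x).card < (A.filter fun z => z < y).card := by
  refine Finset.card_lt_card ⟨fun z hz => ?_, fun hsub => ?_⟩
  · rw [Finset.mem_filter] at hz ⊢
    exact ⟨hz.1, hz.2.trans hxy⟩
  · have : x ∈ A.filter fun z => z < x := hsub (Finset.mem_filter.2 ⟨hx, hxy⟩)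
    exact lt_irrefl _ (Finset.mem_filter.1 this).2

/-- rank is monotone. [bookkeeping] -/
theorem card_filter_lt_mono (A : Finset ℕ) {x y : ℕ} (hxy : x ≤ y) :
    (A.filter fun z => z < x).card ≤ (A.filter fun z => z < y).card :=
  Finset.card_le_card fun z hz => by
    rw [Finset.mem_filter] at hz ⊢
    exact ⟨hz.1, lt_of_lt_of_le hz.2 hxy⟩

/-- rank is at most `#A − 1` on members. [bookkeeping] -/
theorem card_filter_lt_le {A : Finset ℕ} {x : ℕ} (hx : x ∈ A) : (A.filter fun z => z < x).card ≤ A.card - 1 := by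
  have h : (A.filter fun z => z < x) ⊆ A.erase x := fun z hz => by
    rw [Finset.mem_filter] at hz
    exact Finset.mem_erase.2 ⟨hz.2.ne, hz.1⟩
  exact (Finset.card_le_card h).trans (by rw [Finset.card_erase_of_mem hx])

/-- **a chain in a product of two finite sets of naturals is short**: a finset of pairs from `A × B`, pairwise comparable in the product
order, has at most `#A + #B − 1` elements. [elementary: the rank sum is injective on a chain] -/
theorem card_chain_le (A B : Finset ℕ) (S : Finset (ℕ × ℕ)) (hS : ∀ p ∈ S, p.1 ∈ A ∧ p.2 ∈ B)
    (hchain : ∀ p ∈ S, ∀ q ∈ S, (p.1 ≤ q.1 ∧ p.2 ≤ q.2) ∨ (q.1 ≤ p.1 ∧ q.2 ≤ p.2)) :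
    S.card ≤ A.card + B.card - 1 := by
  set Φ : ℕ × ℕ → ℕ := fun p => (A.filter fun z => z < p.1).card + (B.filter fun z => z < p.2).card with hΦ
  have hlt : ∀ p ∈ S, ∀ q ∈ S, p ≠ q → p.1 ≤ q.1 → p.2 ≤ q.2 → Φ p < Φ q := by
    intro p hp q hq hne h1 h2
    obtain ⟨hpA, hpB⟩ := hS p hp
    rcases h1.lt_or_eq with h1 | h1
    · exact Nat.add_lt_add_of_lt_of_le (card_filter_lt_lt hpA h1) (card_filter_lt_mono B h2)
    · rcases h2.lt_or_eq with h2 | h2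
      · exact Nat.add_lt_add_of_le_of_lt (card_filter_lt_mono A h1.le) (card_filter_lt_lt hpB h2)
      · exact absurd (Prod.ext h1 h2) hne
  have hinj : Set.InjOn Φ (S : Set (ℕ × ℕ)) := by
    intro p hp q hq hΦ
    by_contra hne
    rcases hchain p hp q hq with h | h
    · exact absurd hΦ (hlt p hp q hq hne h.1 h.2).ne
    · exact absurd hΦ.symm (hlt q hq p hp (Ne.symm hne) h.1 h.2).ne
  have hrange : ∀ p ∈ S, Φ p ∈ Finset.range (A.card + B.card - 1) := by
    intro p hp
    obtain ⟨hpA, hpB⟩ := hS p hp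
    rw [Finset.mem_range]
    have h1 := card_filter_lt_le hpA
    have h2 := card_filter_lt_le hpB
    have hA : 0 < A.card := Finset.card_pos.2 ⟨_, hpA⟩
    have hB : 0 < B.card := Finset.card_pos.2 ⟨_, hpB⟩
    change (A.filter fun z => z < p.1).card + (B.filter fun z => z < p.2).card < A.card + B.card - 1
    omega
  calc S.card ≤ (Finset.range (A.card + B.card - 1)).card := Finset.card_le_card_of_injOn Φ hrange hinj
    _ = A.card + B.card - 1 := Finset.card_range _

/-- **DOMINANT EXPONENTS OF A PRODUCT ARE FEW** (non-archimedean `v`): the number of exponents of `f * g` that strictly dominate at some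
radius is at most `#D(f) + #D(g) − 1` — the skeleton's `npEdges v (f * g) ≤ npEdges v f + npEdges v g`, spelled on the raw predicate.
[elementary: split each dominant `G` into its pair, pairs form a chain, `card_chain_le`] -/
theorem card_dominant_mul_le (v : AbsoluteValue F ℝ) (hv : IsNonarchimedean v) (f g : F[X]) :
    ((f * g).support.filter fun E => ∃ r : ℝ, 0 < r ∧ ∀ E' ∈ (f * g).support, E' ≠ E →
        v ((f * g).coeff E') * r ^ E' < v ((f * g).coeff E) * r ^ E).card
      ≤ (f.support.filter fun E => ∃ r : ℝ, 0 < r ∧ ∀ E' ∈ f.support, E' ≠ E →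
            v (f.coeff E') * r ^ E' < v (f.coeff E) * r ^ E).card
        + (g.support.filter fun E => ∃ r : ℝ, 0 < r ∧ ∀ E' ∈ g.support, E' ≠ E →
            v (g.coeff E') * r ^ E' < v (g.coeff E) * r ^ E).card - 1 := by
  set Dfg := (f * g).support.filter fun E => ∃ r : ℝ, 0 < r ∧ ∀ E' ∈ (f * g).support, E' ≠ E →
      v ((f * g).coeff E') * r ^ E' < v ((f * g).coeff E) * r ^ E with hDfg
  set Df := f.support.filter fun E => ∃ r : ℝ, 0 < r ∧ ∀ E' ∈ f.support, E' ≠ E →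
      v (f.coeff E') * r ^ E' < v (f.coeff E) * r ^ E with hDf
  set Dg := g.support.filter fun E => ∃ r : ℝ, 0 < r ∧ ∀ E' ∈ g.support, E' ≠ E →
      v (g.coeff E') * r ^ E' < v (g.coeff E) * r ^ E with hDg
  -- support-relative domination ⇒ domination against every index
  have hall : ∀ (h : F[X]) (E : ℕ) (r : ℝ), 0 < r → E ∈ h.support →
      (∀ E' ∈ h.support, E' ≠ E → v (h.coeff E') * r ^ E' < v (h.coeff E) * r ^ E) →
      ∀ x : ℕ, x ≠ E → v (h.coeff x) * r ^ x < v (h.coeff E) * r ^ E := by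
    intro h E r hr hE hdom x hx
    by_cases hxs : x ∈ h.support
    · exact hdom x hxs hx
    · rw [Polynomial.notMem_support_iff.1 hxs, map_zero, zero_mul]
      exact mul_pos (v.pos (Polynomial.mem_support_iff.1 hE)) (pow_pos hr E)
  -- choose a radius and the pair for each dominant G
  have hpair : ∀ G ∈ Dfg, ∃ r : ℝ, ∃ p : ℕ × ℕ, 0 < r ∧ p.1 + p.2 = G ∧ f.coeff p.1 ≠ 0 ∧ g.coeff p.2 ≠ 0 ∧
      (∀ x : ℕ, x ≠ p.1 → v (f.coeff x) * r ^ x < v (f.coeff p.1) * r ^ p.1) ∧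
      (∀ x : ℕ, x ≠ p.2 → v (g.coeff x) * r ^ x < v (g.coeff p.2) * r ^ p.2) := by
    intro G hG
    obtain ⟨hGs, r, hr, hdom⟩ := Finset.mem_filter.1 hG
    obtain ⟨a, b, ha, hb, hab, hda, hdb⟩ := exists_dominant_pair_of_dominant_mul v hv f g hr
      (Polynomial.mem_support_iff.1 hGs) (hall (f * g) G r hr hGs hdom)
    exact ⟨r, (a, b), hr, hab, ha, hb, hda, hdb⟩
  choose! rad pr hrad hsum hfa hgb hda hdb using hpair
  -- the pairs land in Df × Dg, injectively, and form a chain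
  have hmem : ∀ G ∈ Dfg, (pr G).1 ∈ Df ∧ (pr G).2 ∈ Dg := by
    intro G hG
    refine ⟨Finset.mem_filter.2 ⟨Polynomial.mem_support_iff.2 (hfa G hG), rad G, hrad G hG,
        fun E' _ hne => hda G hG E' hne⟩,
      Finset.mem_filter.2 ⟨Polynomial.mem_support_iff.2 (hgb G hG), rad G, hrad G hG,
        fun E' _ hne => hdb G hG E' hne⟩⟩
  have hinj : Set.InjOn pr (Dfg : Set ℕ) := by
    intro G hG G' hG' h
    rw [← hsum G hG, ← hsum G' hG', h]
  have hchain : ∀ p ∈ Dfg.image pr, ∀ q ∈ Dfg.image pr, (p.1 ≤ q.1 ∧ p.2 ≤ q.2) ∨ (q.1 ≤ p.1 ∧ q.2 ≤ p.2) := by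
    intro p hp q hq
    obtain ⟨G, hG, rfl⟩ := Finset.mem_image.1 hp
    obtain ⟨G', hG', rfl⟩ := Finset.mem_image.1 hq
    rcases lt_trichotomy (rad G) (rad G') with h | h | h
    · exact Or.inl ⟨dominantAt_mono v f (hrad G hG) h (hda G hG) (hda G' hG'),
        dominantAt_mono v g (hrad G hG) h (hdb G hG) (hdb G' hG')⟩
    · -- same radius: the dominant pairs coincide
      left
      have h1 : (pr G).1 = (pr G').1 := by
        by_contra hne
        have e1 := hda G hG (pr G').1 (fun h' => hne h'.symm)
        have e2 := hda G' hG' (pr G).1 hne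
        rw [h] at e1
        exact lt_asymm e1 e2
      have h2 : (pr G).2 = (pr G').2 := by
        by_contra hne
        have e1 := hdb G hG (pr G').2 (fun h' => hne h'.symm)
        have e2 := hdb G' hG' (pr G).2 hne
        rw [h] at e1
        exact lt_asymm e1 e2
      exact ⟨h1.le, h2.le⟩
    · exact Or.inr ⟨dominantAt_mono v f (hrad G' hG') h (hda G' hG') (hda G hG),
        dominantAt_mono v g (hrad G' hG') h (hdb G' hG') (hdb G hG)⟩
  calc Dfg.card = (Dfg.image pr).card := (Finset.card_image_of_injOn hinj).symm
    _ ≤ Df.card + Dg.card - 1 := card_chain_le Df Dg (Dfg.image pr) (fun p hp => by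
        obtain ⟨G, hG, rfl⟩ := Finset.mem_image.1 hp
        exact hmem G hG) hchain

/-- `npEdges` form: `#D(f·g) − 1 ≤ (#D(f) − 1) + (#D(g) − 1)` (truncated subtraction). [corollary] -/
theorem npEdges_mul_le (v : AbsoluteValue F ℝ) (hv : IsNonarchimedean v) (f g : F[X]) :
    ((f * g).support.filter fun E => ∃ r : ℝ, 0 < r ∧ ∀ E' ∈ (f * g).support, E' ≠ E →
        v ((f * g).coeff E') * r ^ E' < v ((f * g).coeff E) * r ^ E).card - 1
      ≤ ((f.support.filter fun E => ∃ r : ℝ, 0 < r ∧ ∀ E' ∈ f.support, E' ≠ E →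
            v (f.coeff E') * r ^ E' < v (f.coeff E) * r ^ E).card - 1)
        + ((g.support.filter fun E => ∃ r : ℝ, 0 < r ∧ ∀ E' ∈ g.support, E' ≠ E →
            v (g.coeff E') * r ^ E' < v (g.coeff E) * r ^ E).card - 1) := by
  have h := card_dominant_mul_le v hv f g
  omega

end Summit.ValiantsHypothesis.ValiantsHypothesis.Theorems.KPlusLogSqLaw.ValDoor
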